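import Summits.Ventures.HodgeRepro2.UnitaryReflection
import Summits.Ventures.HodgeRepro2.NonVanishingSelfAdjointHodgePeriod
import Summits.Ventures.HodgeRepro2.HeckeSlashNormalizer

/-!
# A non-trivial self-adjoint Hecke operator exists for every torsion-free congruence subgroup

The (N)-period chain of the p2 annex (rows 137–149) produces, for every rational unitary `δ` with
`δ⁻¹ ∈ S' δ S'`, a holomorphic weight-3 `T_δ`-eigenform with real eigenvalue and non-zero Hodge
period against the vertex form.  The one hypothesis left on the Hecke side was the existence of a
NON-TRIVIAL such `δ` (i.e. `δ ∉ S'`, so that `S' δ S' ≠ S'`) for the specific subgroup `S'`.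

This file closes it: `−r_v` (the negative of a unitary reflection, `UnitaryReflection.lean`) lies in
`SU(H)(K)`, squares to `1` and is `≠ 1`; since `S'` is TORSION-FREE (part of the conclusion of row
141), `−r_v ∉ S'`; and `δ² = 1 ∈ S'` gives `δ⁻¹ ∈ S' δ S'` (`inv_mem_doubleCoset_of_sq_mem`).  So the
closing statement of the chain holds with a `δ` that is exhibited, not assumed:

`NonVanishingInput.exists_involution_hecke_eigenform_hodgePeriod_ne_zero`.

The only new input is `H ≠ 0`, which follows from the frame `Q* J₂₁ Q = τ₁(H)`, `det Q ≠ 0`.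
-/

namespace Summit.Ventures.HodgeRepro2.ShimuraData

open Matrix

variable {K : Type*} [Field K] [NumberField K] [NumberField.IsCMField K]

omit [NumberField K] [NumberField.IsCMField K] in
/-- An involution `δ ≠ 1` does not lie in a torsion-free subgroup. -/
theorem not_mem_of_isTorsionFreeSet_of_mul_self_eq_one {S : Subgroup (GL (Fin 3) K)}
    (hS : IsTorsionFreeSet K (S : Set (GL (Fin 3) K))) {δ : GL (Fin 3) K} (hδ : δ * δ = 1)
    (hδ1 : δ ≠ 1) : δ ∉ S := by
  intro hmem
  apply hδ1
  exact hS δ hmem 2 two_pos (by rw [pow_two]; exact hδ)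

/-- For every hermitian `H ≠ 0` on `K³` and every torsion-free subgroup `S ≤ GL₃(K)` there is
`δ ∈ SU(H)(K)` with `δ² = 1`, `δ ∉ S` and `δ⁻¹ ∈ S δ S`: a non-trivial self-adjoint Hecke
operator `T_δ` on the forms for `S`. -/
theorem exists_involution_not_mem_inv_mem_doubleCoset {H : Matrix (Fin 3) (Fin 3) K}
    (hH : IsHermitianForm K H) (h0 : H ≠ 0) {S : Subgroup (GL (Fin 3) K)}
    (hS : IsTorsionFreeSet K (S : Set (GL (Fin 3) K))) :
    ∃ δ : GL (Fin 3) K, δ ∈ specialUnitaryGroup K H ∧ δ * δ = 1 ∧ δ ∉ S ∧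
      δ⁻¹ ∈ doubleCoset S δ := by
  obtain ⟨δ, hSU, hδδ, hδ1⟩ := exists_involution_mem_specialUnitaryGroup hH h0
  exact ⟨δ, hSU, hδδ, not_mem_of_isTorsionFreeSet_of_mul_self_eq_one hS hδδ hδ1,
    inv_mem_doubleCoset_of_sq_mem (by rw [hδδ]; exact S.one_mem)⟩

omit [NumberField K] [NumberField.IsCMField K] in
/-- A framed hermitian form is non-zero: `Q* J₂₁ Q = τ₁(H)` with `det Q ≠ 0` (`det_J21 = −1` is
`Frame.lean`'s). -/
theorem IsFrame.H_ne_zero {τ₁ : K →+* ℂ} {H : Matrix (Fin 3) (Fin 3) K}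
    {Q : Matrix (Fin 3) (Fin 3) ℂ} (hQ : IsFrame K τ₁ H Q) : H ≠ 0 := by
  rintro rfl
  obtain ⟨h1, h2⟩ := hQ
  rw [Matrix.map_zero _ (map_zero τ₁)] at h1
  have hdet := congrArg Matrix.det h1
  rw [det_mul, det_mul, det_conjTranspose, det_J21, det_zero] at hdet
  have hQd : Q.det ≠ 0 := h2.ne_zero
  have hsQ : star Q.det ≠ 0 := fun h => hQd (star_eq_zero.mp h)
  exact mul_ne_zero (mul_ne_zero hsQ (by norm_num)) hQd hdet

/-- **The closing statement of the Hecke side with the Hecke operator exhibited.**  Under the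
hypotheses of row 141 (`NonVanishingInput.exists_hecke_eigenform_hodgePeriod_ne_zero`): there are a
torsion-free congruence subgroup `S' ⊆ Γ_N` of finite index in `Γ₁` with compact quotient, a
measurable fundamental domain `D`, a holomorphic weight-3 vertex form `f ≢ 0`, AND an element
`δ ∈ SU(H)(K)` with `δ² = 1`, `δ ∉ S'`, `δ⁻¹ ∈ S' δ S'`, together with a holomorphic weight-3
`T_δ`-eigenform `g` for `S'` with real eigenvalue and `∫_D ω_f ∧ conj ω_g ≠ 0`.  No Hecke-side
hypothesis remains. -/
theorem NonVanishingInput.exists_involution_hecke_eigenform_hodgePeriod_ne_zero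
    {τ₁ : K →+* ℂ} {H : Matrix (Fin 3) (Fin 3) K} {Q : Matrix (Fin 3) (Fin 3) ℂ}
    {𝔪 : Submodule ℤ (Fin 3 → K)} (hH : IsHermitianForm K H)
    (hdef : ∀ τ : K →+* ℂ, NumberField.InfinitePlace.mk τ ≠ NumberField.InfinitePlace.mk τ₁ →
      IsDefiniteAt K τ H)
    (hQ : IsFrame K τ₁ H Q) (h𝔪 : IsLattice K 𝔪) (hN : NonVanishingInput K τ₁ H 𝔪 Q)
    {N : ℕ} (hN2 : 2 < N)
    [CompactSpace (ballQuotient hQ (shimuraLevelSubgroup K H 𝔪 1)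
      (shimuraLevelSubgroup_one_subset_unitaryGroup H 𝔪))] :
    ∃ S' : Subgroup (GL (Fin 3) K), ∃ (hS' : (S' : Set (GL (Fin 3) K)) ⊆ shimuraLevel K H 𝔪 N),
      IsTorsionFreeSet K (S' : Set (GL (Fin 3) K)) ∧
      ∃ (hS₁ : S' ≤ shimuraLevelSubgroup K H 𝔪 1)
        (hfin : (S'.subgroupOf (shimuraLevelSubgroup K H 𝔪 1)).FiniteIndex)
        (_hc : CompactSpace (ballQuotient hQ S' (subset_unitaryGroup_of_subset_shimuraLevel hS'))),
      ∃ D : Set ball₂, ∃ (hDm : MeasurableSet D)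
        (hD : IsBallFundamentalDomain hQ S' (subset_unitaryGroup_of_subset_shimuraLevel hS') D),
      ∃ f ∈ holomorphicForms hQ S' (subset_unitaryGroup_of_subset_shimuraLevel hS') 3 hD,
        SeparationQuotient.mk f ≠ 0 ∧
        ∃ δ : unitaryGroup K H, (δ : GL (Fin 3) K) ∈ specialUnitaryGroup K H ∧
          (δ : GL (Fin 3) K) * δ = 1 ∧ (δ : GL (Fin 3) K) ∉ S' ∧
          (δ : GL (Fin 3) K)⁻¹ ∈ doubleCoset S' δ ∧
          ∃ g ∈ holomorphicForms hQ S' (subset_unitaryGroup_of_subset_shimuraLevel hS') 3 hD,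
            (∃ r : ℝ, heckeFamilyOf hQ S' (subset_unitaryGroup_of_subset_shimuraLevel hS') 3 hD hDm
                (fun δ => fintypeHeckeQuotientOfFiniteIndex h𝔪 hS₁ hfin δ.property) δ
                (SeparationQuotient.mk g) = (r : ℂ) • SeparationQuotient.mk g) ∧
            ∫ x in Subtype.val '' D,
              hodgeWedge (PeterssonForms.toForm hQ S'
                  (subset_unitaryGroup_of_subset_shimuraLevel hS') 3 hD f : (Fin 2 → ℂ) → ℂ)
                (PeterssonForms.toForm hQ S'
                  (subset_unitaryGroup_of_subset_shimuraLevel hS') 3 hD g : (Fin 2 → ℂ) → ℂ) x ≠ 0 := by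
  obtain ⟨S', hS', htf, hS₁, hfin, hc, D, hDm, hD, f, hf, hf0, hδ⟩ :=
    NonVanishingInput.exists_hecke_eigenform_hodgePeriod_ne_zero hH hdef hQ h𝔪 hN hN2
  obtain ⟨δ, hSU, hδδ, hδS, hinv⟩ :=
    exists_involution_not_mem_inv_mem_doubleCoset hH hQ.H_ne_zero htf
  have hδU : δ ∈ unitaryGroup K H := (Subgroup.mem_inf.mp hSU).1
  exact ⟨S', hS', htf, hS₁, hfin, hc, D, hDm, hD, f, hf, hf0, ⟨δ, hδU⟩, hSU, hδδ, hδS, hinv,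
    hδ ⟨δ, hδU⟩ hinv⟩

end Summit.Ventures.HodgeRepro2.ShimuraData
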